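import Summits.KontsevichZagierPeriods.KontsevichZagierPeriods.Theorems.LogPrimitiveNL.Negative.Rigidity
import Summits.KontsevichZagierPeriods.KontsevichZagierPeriods.Theorems.LiouvilleUnfoldingLogPrimitiveNLStubTransferAux
import Summits.KontsevichZagierPeriods.KontsevichZagierPeriods.Theorems.LiouvilleUnfoldingUnfoldedLogStokesStubNullNormalise
import Literature.NumberTheory.Transcendental.KZLogCalculusProofs
import Literature.NumberTheory.Transcendental.SemialgebraicDerivativeProofs

/-!
# `LogPrimitiveNL` (stmt-KontsevichZagierPeriods-2836) — line `logderiv-peeling`,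
stub `stub_transfer` (T2, transfer): min-normalisation and boundary rigidity imply the crux

The crux is the logarithmic Newton–Leibniz step
`[band, Σᵢ hᵢ ∂ₜVᵢ/Vᵢ] − [τ, Σᵢ hᵢ (log Vᵢ(·, b) − log Vᵢ(·, a))] ∈ KZ.relations`. This file proves
`stub_transfer : MinNormalisation → Negative.BoundaryRigidity → LogPrimitiveNL` (all three spelled
out verbatim, as registered for line `logderiv-peeling`), i.e. that modulo the fibre-minimum
normalisation (stub `stub_minNormalisation`, another file) the whole content of the crux is the
base-only statement `Negative.BoundaryRigidity`
(`Theorems/LogPrimitiveNL/Negative/Rigidity.lean`; the converse `boundaryRigidity_of_crux` is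
proved there).

Proof (work file `Cruxes/LogPrimitiveNL/Disproof.lean`, §7.2 and §8). With `τ = r'.domain` and
`r.domain = KZlog.band τ a b`:
1. for each `i`, the fibre minimum `mᵢ` of `Vᵢ` (Hypothesis 1) renormalises `Ṽᵢ = Vᵢ/mᵢ ≥ 1` with
   integrable endpoint monomials `hᵢ log Ṽᵢ(·, b)`, `hᵢ log Ṽᵢ(·, a)`, and the min-normalised
   instance of the tree engine `KZ.unfoldedLogStokes_mem_relations`
   (`transfer_engineInstance`, auxiliary file) gives `[RBᵢ] − [Ubᵢ] − [Uaᵢ] ∈ KZ.relations`;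
2. `[r] − [band, Σᵢ RBᵢ.integrand] ∈ KZ.relations` because the integrands agree off the null
   graphs of `a` and `b` (`hr`, `Engine.stub_nullNormalise`), and the latter splits into
   `Σᵢ [RBᵢ]` (`KZ.of_sub_of_sub_sum_mem_relations`);
3. `Negative.BoundaryRigidity` for `g = r'` and the `2k` monomials `(hᵢ, Ṽᵢ(·, b))`,
   `(−hᵢ, Ṽᵢ(·, a))` (its hypothesis `r'.integrand = Σ …` is `hr'` after `log (V/m) = log V − log m`)
   gives `Σᵢ [Ubᵢ] + Σᵢ [Uaᵢ] − [r'] ∈ KZ.relations`;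
4. assemble in the free abelian group.
All four load-bearing hypotheses of Disproof.lean §4 (`hab`, `hcont`, `hderiv`, `hdom`) are consumed
(by Hypothesis 1 and by the engine).
-/

noncomputable section

open Set MeasureTheory
open Literature.NumberTheory.Transcendental Literature.ModelTheory.ExponentialFields

namespace Summit.KontsevichZagierPeriods.LiouvilleUnfolding.LogPrimitiveNL

/-- **T2, transfer**: min-normalisation and boundary rigidity imply the crux `LogPrimitiveNL`
(expanded verbatim; `Negative.crux_iff` is `Iff.rfl`). With `τ = r'.domain` and the band
`r.domain = KZlog.band τ a b` (`hdom`): for each `i` take the fibre minimum `mᵢ` of Hypothesis 1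
(uses `hcont`, `hderiv`, `hab`) and run the min-normalised instance of the tree engine
`transfer_engineInstance` (`KZ.unfoldedLogStokes_mem_relations` with `H = hᵢ ∘ Fin.init`, `H' = 0`,
`Ṽᵢ = Vᵢ/mᵢ ≥ 1`, the `ℚ`-semialgebraic zero-extension of the fibre velocity): this gives
`[RBᵢ] − [Ubᵢ] − [Uaᵢ] ∈ KZ.relations` with `RBᵢ = [band, ·]` of integrand `hᵢ Vᵢ'/Vᵢ` on open
fibres and the unfolded endpoint monomials `Ubᵢ = [{1 ≤ u ≤ Ṽᵢ(x, b x)}, hᵢ x/u]`,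
`Uaᵢ = [{1 ≤ u ≤ Ṽᵢ(x, a x)}, −hᵢ x/u]`. Then `[r] ∼ [band, Σᵢ RBᵢ.integrand]` (the integrands
agree off the null graphs of `a`, `b` by `hr`; `Engine.stub_nullNormalise`) `∼ Σᵢ [RBᵢ]`
(`KZ.of_sub_of_sub_sum_mem_relations`), and `Negative.BoundaryRigidity` applied to `g = r'` with the
`2k` monomials `(hᵢ, Ṽᵢ(·, b))`, `(−hᵢ, Ṽᵢ(·, a))` (its hypothesis `g.integrand = Σ …` is `hr'`, the
`log mᵢ` cancelling) gives `Σᵢ [Ubᵢ] + Σᵢ [Uaᵢ] − [r'] ∈ KZ.relations`; assemble. -/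
theorem stub_transfer :
    (∀ (n : ℕ) (τ : Set (Fin n → ℝ)) (a b : (Fin n → ℝ) → ℝ) (h : (Fin n → ℝ) → ℝ)
      (V V' : (Fin (n + 1) → ℝ) → ℝ),
      IsSemialgebraic ℚ τ → IsSemialgebraicFunOn ℚ τ a → IsSemialgebraicFunOn ℚ τ b →
      (∀ x ∈ τ, a x ≤ b x) → IsSemialgebraicFunOn ℚ τ h →
      IsSemialgebraicFunOn ℚ {z | (Fin.init z : Fin n → ℝ) ∈ τ ∧ a (Fin.init z) ≤ z (Fin.last n) ∧
        z (Fin.last n) ≤ b (Fin.init z)} V →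
      (∀ z ∈ {z | (Fin.init z : Fin n → ℝ) ∈ τ ∧ a (Fin.init z) ≤ z (Fin.last n) ∧
        z (Fin.last n) ≤ b (Fin.init z)}, 0 < V z) →
      (∀ x ∈ τ, ContinuousOn (fun t : ℝ => V (Fin.snoc x t)) (Set.Icc (a x) (b x))) →
      (∀ x ∈ τ, ∀ t ∈ Set.Ioo (a x) (b x),
        HasDerivAt (fun s : ℝ => V (Fin.snoc x s)) (V' (Fin.snoc x t)) t) →
      IntegrableOn (fun z => h (Fin.init z) * V' z / V z)
        {z | (Fin.init z : Fin n → ℝ) ∈ τ ∧ a (Fin.init z) ≤ z (Fin.last n) ∧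
          z (Fin.last n) ≤ b (Fin.init z)} →
      ∃ m : (Fin n → ℝ) → ℝ, IsSemialgebraicFunOn ℚ τ m ∧ (∀ x ∈ τ, 0 < m x) ∧
        (∀ x ∈ τ, ∀ t ∈ Set.Icc (a x) (b x), m x ≤ V (Fin.snoc x t)) ∧
        IntegrableOn (fun x => h x * Real.log (V (Fin.snoc x (b x)) / m x)) τ ∧
        IntegrableOn (fun x => h x * Real.log (V (Fin.snoc x (a x)) / m x)) τ) →
    Negative.BoundaryRigidity →
    ∀ (n k : ℕ) (r : KZ.IntegralRep (n + 1)) (r' : KZ.IntegralRep n) (a b : (Fin n → ℝ) → ℝ)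
      (h : Fin k → (Fin n → ℝ) → ℝ) (V V' : Fin k → (Fin (n + 1) → ℝ) → ℝ),
      IsSemialgebraicFunOn ℚ r'.domain a → IsSemialgebraicFunOn ℚ r'.domain b →
      (∀ x ∈ r'.domain, a x ≤ b x) →
      r.domain = {z | (Fin.init z : Fin n → ℝ) ∈ r'.domain ∧ a (Fin.init z) ≤ z (Fin.last n) ∧
        z (Fin.last n) ≤ b (Fin.init z)} →
      (∀ i, IsSemialgebraicFunOn ℚ r'.domain (h i)) →
      (∀ i, IsSemialgebraicFunOn ℚ r.domain (V i)) →
      (∀ i, ∀ z ∈ r.domain, 0 < V i z) →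
      (∀ i, ∀ x ∈ r'.domain, ContinuousOn (fun t : ℝ => V i (Fin.snoc x t)) (Set.Icc (a x) (b x))) →
      (∀ i, ∀ x ∈ r'.domain, ∀ t ∈ Set.Ioo (a x) (b x),
        HasDerivAt (fun s : ℝ => V i (Fin.snoc x s)) (V' i (Fin.snoc x t)) t) →
      (∀ i, IntegrableOn (fun z => h i (Fin.init z) * V' i z / V i z) r.domain) →
      (∀ x ∈ r'.domain, ∀ t ∈ Set.Ioo (a x) (b x),
        r.integrand (Fin.snoc x t) = ∑ i, h i x * V' i (Fin.snoc x t) / V i (Fin.snoc x t)) →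
      (∀ x ∈ r'.domain, r'.integrand x =
        ∑ i, h i x * (Real.log (V i (Fin.snoc x (b x))) - Real.log (V i (Fin.snoc x (a x))))) →
      KZ.of r - KZ.of r' ∈ KZ.relations := by
  intro hMN hBR n k r r' a b h V V' ha hb hab hdom hh hV hpos hcont hderiv hint hr hr'
  -- the base `τ = r'.domain` and the band `r.domain = KZlog.band τ a b`
  have hτ : IsSemialgebraic ℚ r'.domain := r'.isSemialgebraic_domain
  have hτm : MeasurableSet r'.domain := IsSemialgebraic.measurableSet_holds hτ
  have hdom' : r.domain = KZlog.band r'.domain a b := hdom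
  have hB : IsSemialgebraic ℚ (KZlog.band r'.domain a b) := KZlog.isSemialgebraic_band ha hb
  have hmemB : ∀ x ∈ r'.domain, ∀ t ∈ Icc (a x) (b x),
      (Fin.snoc x t : Fin (n + 1) → ℝ) ∈ KZlog.band r'.domain a b :=
    fun x hx t ht => KZlog.snoc_mem_band.2 ⟨hx, ht⟩
  have hVB : ∀ i, IsSemialgebraicFunOn ℚ (KZlog.band r'.domain a b) (V i) := fun i => hdom' ▸ hV i
  have hposB : ∀ i, ∀ z ∈ KZlog.band r'.domain a b, 0 < V i z := fun i => hdom' ▸ hpos i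
  have hintB : ∀ i, IntegrableOn (fun z => h i (Fin.init z) * V' i z / V i z)
      (KZlog.band r'.domain a b) := fun i => hdom' ▸ hint i
  -- Hypothesis 1: the fibre minima `mᵢ` (uses `hab`, `hcont`, `hderiv`, `hdom`)
  choose m hm hm0 hmV hintb hinta using fun i =>
    hMN n r'.domain a b (h i) (V i) (V' i) hτ ha hb hab (hh i) (hVB i) (hposB i) (hcont i)
      (hderiv i) (hintB i)
  -- the min-normalised engine, once per monomial
  choose RB Ub Ua hRBd hRBi hUbd hUbi hUad hUai hrel using fun i =>
    transfer_engineInstance n r'.domain a b (h i) (m i) (V i) (V' i) hτ ha hb hab (hh i) (hVB i)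
      (hcont i) (hderiv i) (hintB i) (hm i) (hm0 i) (hmV i) (hintb i) (hinta i)
  -- Step 1: `[r] ∼ [band, Σᵢ RBᵢ.integrand] ∼ Σᵢ [RBᵢ]`
  let R : KZ.IntegralRep (n + 1) :=
    { domain := KZlog.band r'.domain a b
      integrand := fun z => ∑ i, (RB i).integrand z
      isSemialgebraic_domain := hB
      isSemialgebraicFunOn_integrand := KZ.isSemialgebraicFunOn_finset_sum _ hB fun i _ =>
        hRBd i ▸ (RB i).isSemialgebraicFunOn_integrand
      integrableOn := integrable_finsetSum _ fun i _ => hRBd i ▸ (RB i).integrableOn }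
  obtain ⟨z0, hz0d, hz0i⟩ := KZ.exists_zeroRep hB
  have hsplit : KZ.of R - KZ.of z0 - ∑ i, KZ.of (RB i) ∈ KZ.relations :=
    KZ.of_sub_of_sub_sum_mem_relations k R z0 RB hz0d hRBd fun z _ => by simp [hz0i, R]
  have hz0 : KZ.of z0 ∈ KZ.relations :=
    KZ.of_mem_relations_of_eqOn_zero z0 fun z _ => by simp [hz0i]
  have hN : IsSemialgebraic ℚ
      ({z : Fin (n + 1) → ℝ | Fin.init z ∈ r'.domain ∧ z (Fin.last n) = a (Fin.init z)} ∪
        {z : Fin (n + 1) → ℝ | Fin.init z ∈ r'.domain ∧ z (Fin.last n) = b (Fin.init z)}) :=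
    (isSemialgebraicFunOn_iff.mp ha).union (isSemialgebraicFunOn_iff.mp hb)
  have hN0 : volume
      ({z : Fin (n + 1) → ℝ | Fin.init z ∈ r'.domain ∧ z (Fin.last n) = a (Fin.init z)} ∪
        {z : Fin (n + 1) → ℝ | Fin.init z ∈ r'.domain ∧ z (Fin.last n) = b (Fin.init z)}) = 0 :=
    measure_union_null (KZ.volume_graph_eq_zero ha) (KZ.volume_graph_eq_zero hb)
  have hrR : KZ.of r - KZ.of R ∈ KZ.relations := by
    refine Engine.stub_nullNormalise (n + 1) r R _ hdom'.symm hN hN0 fun z hz => ?_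
    obtain ⟨hzD, hzN⟩ := hz
    rw [hdom'] at hzD
    have hx : Fin.init z ∈ r'.domain := hzD.1
    have hta : a (Fin.init z) < z (Fin.last n) :=
      lt_of_le_of_ne hzD.2.1 fun e => hzN (Or.inl ⟨hx, e.symm⟩)
    have htb : z (Fin.last n) < b (Fin.init z) :=
      lt_of_le_of_ne hzD.2.2 fun e => hzN (Or.inr ⟨hx, e⟩)
    rw [← Fin.snoc_init_self z, hr _ hx _ ⟨hta, htb⟩]
    show _ = ∑ i, (RB i).integrand _
    exact Finset.sum_congr rfl fun i _ => (hRBi i _ hx _ ⟨hta, htb⟩).symm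
  -- Step 2: boundary rigidity with the `2k` min-normalised endpoint monomials
  have hWb : ∀ i, IsSemialgebraicFunOn ℚ r'.domain (fun x => V i (Fin.snoc x (b x)) / m i x) :=
    fun i => (transfer_isSemialgebraicFunOn_comp_snoc hτ (hVB i) hb fun x hx =>
      hmemB x hx _ ⟨hab x hx, le_rfl⟩).div (hm i) fun x hx => (hm0 i x hx).ne'
  have hWa : ∀ i, IsSemialgebraicFunOn ℚ r'.domain (fun x => V i (Fin.snoc x (a x)) / m i x) :=
    fun i => (transfer_isSemialgebraicFunOn_comp_snoc hτ (hVB i) ha fun x hx =>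
      hmemB x hx _ ⟨le_rfl, hab x hx⟩).div (hm i) fun x hx => (hm0 i x hx).ne'
  have hWb1 : ∀ i, ∀ x ∈ r'.domain, 1 ≤ V i (Fin.snoc x (b x)) / m i x := fun i x hx =>
    (one_le_div (hm0 i x hx)).2 (hmV i x hx _ ⟨hab x hx, le_rfl⟩)
  have hWa1 : ∀ i, ∀ x ∈ r'.domain, 1 ≤ V i (Fin.snoc x (a x)) / m i x := fun i x hx =>
    (one_le_div (hm0 i x hx)).2 (hmV i x hx _ ⟨le_rfl, hab x hx⟩)
  have hbr : ∑ i, KZ.of (Fin.append Ub Ua i) - KZ.of r' ∈ KZ.relations := by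
    refine hBR n (k + k) r' (Fin.append h fun i x => -h i x)
      (Fin.append (fun i x => V i (Fin.snoc x (b x)) / m i x)
        fun i x => V i (Fin.snoc x (a x)) / m i x)
      (Fin.append Ub Ua) ?_ ?_ ?_ ?_ ?_ ?_ ?_
    · refine (Fin.forall_fin_add _).2 ⟨fun i => ?_, fun i => ?_⟩
      · simpa only [Fin.append_left] using hh i
      · simp only [Fin.append_right]
        exact (hh i).neg.congr fun _ _ => rfl
    · refine (Fin.forall_fin_add _).2 ⟨fun i => ?_, fun i => ?_⟩
      · simpa only [Fin.append_left] using hWb i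
      · simpa only [Fin.append_right] using hWa i
    · refine (Fin.forall_fin_add _).2 ⟨fun i => ?_, fun i => ?_⟩
      · simpa only [Fin.append_left] using hWb1 i
      · simpa only [Fin.append_right] using hWa1 i
    · refine (Fin.forall_fin_add _).2 ⟨fun i => ?_, fun i => ?_⟩
      · simp only [Fin.append_left]
        exact hUbd i
      · simp only [Fin.append_right]
        exact hUad i
    · refine (Fin.forall_fin_add _).2 ⟨fun i => ?_, fun i => ?_⟩
      · simp only [Fin.append_left]
        intro z _
        simp only [hUbi i]
      · simp only [Fin.append_right]
        intro z _
        simp only [hUai i]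
    · refine (Fin.forall_fin_add _).2 ⟨fun i => ?_, fun i => ?_⟩
      · simpa only [Fin.append_left] using hintb i
      · simp only [Fin.append_right]
        simpa [neg_mul] using (hinta i).neg
    · intro x hx
      rw [Fin.sum_univ_add]
      simp only [Fin.append_left, Fin.append_right]
      rw [hr' x hx, ← Finset.sum_add_distrib]
      refine Finset.sum_congr rfl fun i _ => ?_
      have hVb0 : V i (Fin.snoc x (b x)) ≠ 0 := (hposB i _ (hmemB x hx _ ⟨hab x hx, le_rfl⟩)).ne'
      have hVa0 : V i (Fin.snoc x (a x)) ≠ 0 := (hposB i _ (hmemB x hx _ ⟨le_rfl, hab x hx⟩)).ne'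
      rw [Real.log_div hVb0 (hm0 i x hx).ne', Real.log_div hVa0 (hm0 i x hx).ne']
      ring
  have hbr' : ∑ i, KZ.of (Ub i) + ∑ i, KZ.of (Ua i) - KZ.of r' ∈ KZ.relations := by
    have e := hbr
    rw [Fin.sum_univ_add] at e
    simpa only [Fin.append_left, Fin.append_right] using e
  -- assembly
  have hsum : ∑ i, (KZ.of (RB i) - KZ.of (Ub i) - KZ.of (Ua i)) ∈ KZ.relations :=
    AddSubgroup.sum_mem _ fun i _ => hrel i
  have e : KZ.of r - KZ.of r' =
      (KZ.of r - KZ.of R) + (KZ.of R - KZ.of z0 - ∑ i, KZ.of (RB i)) + KZ.of z0 +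
        ∑ i, (KZ.of (RB i) - KZ.of (Ub i) - KZ.of (Ua i)) +
        (∑ i, KZ.of (Ub i) + ∑ i, KZ.of (Ua i) - KZ.of r') := by
    simp only [Finset.sum_sub_distrib]
    abel
  rw [e]
  exact KZ.relations.add_mem (KZ.relations.add_mem (KZ.relations.add_mem
    (KZ.relations.add_mem hrR hsplit) hz0) hsum) hbr'

end Summit.KontsevichZagierPeriods.LiouvilleUnfolding.LogPrimitiveNL

end
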